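import Summits.ValiantsHypothesis.ValiantsHypothesis.Theorems.KPlusLogSqLawWeakLiftingTowerGraftTwoSidedAllSupports
import Summits.ValiantsHypothesis.ValiantsHypothesis.Theorems.KPlusLogSqLawWeakLiftingTowerGraftTwoSidedThreeLettersDefinite
import Summits.ValiantsHypothesis.ValiantsHypothesis.Theorems.LacunarySymmetroidMatrixDescartesInertiaIndexFormula

/-!
# Tower graft line — THE TWO-SIDED THREE-LETTER `2m` LAW ON EVERY SUPPORT, DEFINITE TYPE (any corank)

Crux `stmt-ValiantsHypothesis-19561` (`WeakLifting`), line (B) `tower_graft`, two-sided word instrument; seat val-sym-lift-p3 g21,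
`--supports 19561`, NO stub claimed.  `…TwoSidedAllSupports` proves `Z₊ ≤ 2m` on every support `(d₀, d₀+e, d₀+e+f)` under SIMPLE
CROSSINGS.  As parts D/E′/I/K did for their supports, the corank restriction is removed here: if every positive root of
`det (X^{d₀} A + X^{d₀+e} J + X^{d₀+e+f} B)` (`A ≻ 0`, `B ≻ 0`, `J` ANY symmetric, `e, f ≥ 1`) is of DEFINITE type, then the positive
roots counted WITH MULTIPLICITY number at most `2m` (`card_posRoots_le_two_mul_two_gaps_of_definite`; literal `a < b < c` form
`card_posRoots_le_two_mul_of_lt_of_definite`).  Route: `N^± = Σ corank` (`Inertia.sum_corank_eq_card_roots_filter`), orthogonal kernel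
bases for the form `f t^{e+f} B − e A` (`exists_kernel_orthogonal_family`) feeding the FAMILY two-gap laws
`card_posType_family_le_rank_two_gaps` (`e ≤ f`) / `card_negType_family_le_rank_two_gaps` (`f ≤ e`), and the global index formula.
What remains outside the whole series: roots with a NEUTRAL kernel vector (`P_u′(t) = 0`).  HONEST FRAMING: a structural law for three
letters on all supports; nothing on the four-letter tower column, S4…S5, `TowerB`, `WeakLifting` in its window, Conjecture B, 18050 or
`VP ≠ VNP`.  Def-free.

[folklore] Loewner certificates + the inertia kit.
-/

set_option linter.dupNamespace false
set_option autoImplicit false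

namespace Summit.ValiantsHypothesis.ValiantsHypothesis.Theorems.KPlusLogSqLaw.TowerGraft

open Matrix
open scoped BigOperators

namespace TwoSidedThree

/-! ## The census-currency `2m` law for DEFINITE-TYPE roots of any corank on EVERY three-letter support -/

section AllSupportsDefinite

open Polynomial
open Summit.ValiantsHypothesis.ValiantsHypothesis.Theorems.LacunarySymmetroidMatrixDescartes

variable {m : ℕ}

/-- **THE `2m` LAW ON EVERY SUPPORT, DEFINITE TYPE (any corank).**  `A ≻ 0`, `B ≻ 0`, `J` ANY symmetric, `e, f ≥ 1`,
`F(X) = X^{d₀} A + X^{d₀+e} J + X^{d₀+e+f} B`; if every positive root of `det F` is of DEFINITE type (the kernel form `u ↦ P_u′(t)`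
definite on `ker F(t)`, any corank) then `det F` has at most `2m` positive roots COUNTED WITH MULTIPLICITY.  Route: the global index
formula (`Z₊ = N⁻ + N⁺`, `N⁻ = N⁺` since `ν(A) = ν(B) = 0`), `N^± = Σ corank` over the distinct roots of that type
(`Inertia.sum_corank_eq_card_roots_filter`), orthogonal kernel bases for the form `f t^{e+f} B − e A` at each such root
(`exists_kernel_orthogonal_family`), and ONE of the two unconditional Loewner family laws: `N⁺ ≤ rank B` if `e ≤ f`
(`card_posType_family_le_rank_two_gaps`), `N⁻ ≤ rank A` if `f ≤ e` (`card_negType_family_le_rank_two_gaps`).  Parts D/E′/I/K are the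
supports `f = 2e, 4e` (and the clustered four-letter words); NEUTRAL kernel vectors (`P_u′(t) = 0`) remain outside every file of the
series. [folklore] -/
theorem card_posRoots_le_two_mul_two_gaps_of_definite (A J B : Matrix (Fin m) (Fin m) ℝ) (hA : A.PosDef) (hJ : J.IsSymm)
    (hB : B.PosDef) (d₀ e f : ℕ) (he : 0 < e) (hf : 0 < f)
    (htype : ∀ t : ℝ, 0 < t → (∑ k : Fin 3, t ^ (![d₀, d₀ + e, d₀ + e + f] k) • (![A, J, B] k)).det = 0 →
      (∀ u : Fin m → ℝ, (∑ k : Fin 3, t ^ (![d₀, d₀ + e, d₀ + e + f] k) • (![A, J, B] k)) *ᵥ u = 0 → u ≠ 0 →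
        (derivative (∑ k : Fin 3, C (u ⬝ᵥ ((![A, J, B] k) *ᵥ u)) * (X : ℝ[X]) ^ (![d₀, d₀ + e, d₀ + e + f] k))).eval t < 0) ∨
      (∀ u : Fin m → ℝ, (∑ k : Fin 3, t ^ (![d₀, d₀ + e, d₀ + e + f] k) • (![A, J, B] k)) *ᵥ u = 0 → u ≠ 0 →
        0 < (derivative (∑ k : Fin 3, C (u ⬝ᵥ ((![A, J, B] k) *ᵥ u)) * (X : ℝ[X]) ^ (![d₀, d₀ + e, d₀ + e + f] k))).eval t)) :
    Multiset.card ((Matrix.det (∑ k : Fin 3, ((X : ℝ[X]) ^ (![d₀, d₀ + e, d₀ + e + f] k)) • (![A, J, B] k).map C)).roots.filter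
        (fun t => 0 < t)) ≤ 2 * m := by
  classical
  set dv : Fin 3 → ℕ := ![d₀, d₀ + e, d₀ + e + f] with hdv
  set Sv : Fin 3 → Matrix (Fin m) (Fin m) ℝ := ![A, J, B] with hSv
  have hAs : A.IsSymm := by
    have h1 := hA.1; unfold Matrix.IsHermitian at h1
    rwa [Matrix.conjTranspose_eq_transpose_of_trivial] at h1
  have hBs : B.IsSymm := by
    have h1 := hB.1; unfold Matrix.IsHermitian at h1
    rwa [Matrix.conjTranspose_eq_transpose_of_trivial] at h1
  have hS : ∀ k, (Sv k).IsSymm := by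
    intro k; fin_cases k
    · exact hAs
    · exact hJ
    · exact hBs
  have hmin : ∀ l : Fin 3, l ≠ 0 → dv 0 < dv l := by
    intro l hl; fin_cases l
    · exact absurd rfl hl
    · show d₀ < d₀ + e; omega
    · show d₀ < d₀ + e + f; omega
  have hmax : ∀ l : Fin 3, l ≠ 2 → dv l < dv 2 := by
    intro l hl; fin_cases l
    · show d₀ < d₀ + e + f; omega
    · show d₀ + e < d₀ + e + f; omega
    · exact absurd rfl hl
  have h0 : (Sv 0).det ≠ 0 := by show A.det ≠ 0; exact hA.det_pos.ne'
  have h2 : (Sv 2).det ≠ 0 := by show B.det ≠ 0; exact hB.det_pos.ne'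
  let negType : ℝ → Prop := fun t => ∀ u : Fin m → ℝ, (∑ k, t ^ dv k • Sv k) *ᵥ u = 0 → u ≠ 0 →
    (derivative (∑ k, C (u ⬝ᵥ (Sv k *ᵥ u)) * (X : ℝ[X]) ^ dv k)).eval t < 0
  obtain ⟨hidx, -, hsum⟩ := Inertia.global_index_formula dv Sv hS 0 2 hmin hmax h0 h2 htype negType
    (fun t _ _ => Iff.rfl)
  have hνA : Fintype.card {j // (Inertia.isHermitian_of_isSymm (hS 0)).eigenvalues j < 0} = 0 := by
    rw [Fintype.card_eq_zero_iff]
    refine ⟨fun ⟨j, hj⟩ => ?_⟩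
    have hp : 0 < (Inertia.isHermitian_of_isSymm (hS 0)).eigenvalues j := hA.eigenvalues_pos j
    linarith
  have hνB : Fintype.card {j // (Inertia.isHermitian_of_isSymm (hS 2)).eigenvalues j < 0} = 0 := by
    rw [Fintype.card_eq_zero_iff]
    refine ⟨fun ⟨j, hj⟩ => ?_⟩
    have hp : 0 < (Inertia.isHermitian_of_isSymm (hS 2)).eigenvalues j := hB.eigenvalues_pos j
    linarith
  rw [hνA, hνB, zero_add, zero_add] at hidx
  set P := Matrix.det (∑ k, ((X : ℝ[X]) ^ dv k) • (Sv k).map C) with hP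
  -- definite type at every positive root (for the corank count)
  have hdefq : ∀ (q : ℝ → Prop) [DecidablePred q], (∀ t, q t → 0 < t) → ∀ t ∈ P.roots.toFinset.filter q,
      ∀ v : Fin m → ℝ, (∑ k, t ^ dv k • Sv k) *ᵥ v = 0 → v ≠ 0 →
      (derivative (∑ k, C (v ⬝ᵥ (Sv k *ᵥ v)) * (X : ℝ[X]) ^ dv k)).eval t ≠ 0 := by
    intro q _ hq t ht v hv hv0
    obtain ⟨hmem, htq⟩ := Finset.mem_filter.mp ht
    obtain ⟨-, hroot⟩ := (Polynomial.mem_roots').mp (Multiset.mem_toFinset.mp hmem)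
    have hdet : (∑ k, t ^ dv k • Sv k).det = 0 := by
      have h1 : P.eval t = 0 := hroot
      rwa [hP, DefiniteMoments.eval_det_pencil] at h1
    rcases htype t (hq t htq) hdet with h | h
    · exact ne_of_lt (h v hv hv0)
    · exact ne_of_gt (h v hv hv0)
  -- roots in a filtered finset are roots of the evaluated pencil
  have hdetT : ∀ (q : ℝ → Prop) [DecidablePred q], ∀ t ∈ P.roots.toFinset.filter q, (∑ k, t ^ dv k • Sv k).det = 0 := by
    intro q _ t ht
    obtain ⟨hmem, -⟩ := Finset.mem_filter.mp ht
    obtain ⟨-, hroot⟩ := (Polynomial.mem_roots').mp (Multiset.mem_toFinset.mp hmem)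
    have h1 : P.eval t = 0 := hroot
    rwa [hP, DefiniteMoments.eval_det_pencil] at h1
  -- an orthogonal kernel family at every positive real, for the form `f t^{e+f} B − e A`
  have hfam : ∀ t : ℝ, ∃ v : Fin (m - (∑ k, t ^ dv k • Sv k).rank) → (Fin m → ℝ),
      (∀ j, (∑ k, t ^ dv k • Sv k) *ᵥ v j = 0) ∧ (∀ j, v j ≠ 0) ∧
      ∀ j j', j ≠ j' → v j ⬝ᵥ ((((f : ℝ) * t ^ (e + f)) • B - (e : ℝ) • A) *ᵥ v j') = 0 := by
    intro t
    refine exists_kernel_orthogonal_family _ _ ?_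
    unfold Matrix.IsSymm
    rw [Matrix.transpose_sub, Matrix.transpose_smul, Matrix.transpose_smul, hAs, hBs]
  choose v hv0 hvne hvorth using hfam
  -- the polarised same-scale relation delivered by the orthogonal families
  have hpol : ∀ t : ℝ, ∀ j j', j ≠ j' →
      (f : ℝ) * t ^ (e + f) * (v t j ⬝ᵥ (B *ᵥ v t j')) = e * (v t j ⬝ᵥ (A *ᵥ v t j')) := by
    intro t j j' hjj
    have h := hvorth t j j' hjj
    rw [Matrix.sub_mulVec, Matrix.smul_mulVec, Matrix.smul_mulVec, dotProduct_sub, dotProduct_smul, dotProduct_smul,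
      smul_eq_mul, smul_eq_mul, sub_eq_zero] at h
    exact h
  have hAm : A.rank ≤ m := (Matrix.rank_le_width A).trans le_rfl
  have hBm : B.rank ≤ m := (Matrix.rank_le_width B).trans le_rfl
  rw [← hsum]
  rcases le_total e f with hef | hfe
  · -- `e ≤ f`: `N⁺ = Σ corank ≤ rank B`
    set q : ℝ → Prop := fun t => 0 < t ∧ ¬ negType t with hq
    set T := P.roots.toFinset.filter q with hTdef
    have hTpos : ∀ t ∈ T, 0 < t := fun t ht => (Finset.mem_filter.mp ht).2.1
    have hN : ∑ t ∈ T, (Fintype.card (Fin m) - (∑ k, t ^ dv k • Sv k).rank) = Multiset.card (P.roots.filter q) :=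
      Inertia.sum_corank_eq_card_roots_filter dv Sv hS q (hdefq q fun t ht => ht.1)
    have hTtype : ∀ t ∈ T, ∀ u : Fin m → ℝ, (∑ k, t ^ dv k • Sv k) *ᵥ u = 0 → u ≠ 0 →
        0 < (derivative (∑ k, C (u ⬝ᵥ (Sv k *ᵥ u)) * (X : ℝ[X]) ^ dv k)).eval t := by
      intro t ht u hu hu0
      have htq := (Finset.mem_filter.mp ht).2
      rcases htype t htq.1 (hdetT q t ht) with hneg | hposT
      · exact absurd hneg htq.2
      · exact hposT u hu hu0
    let Idx := Σ t : T, Fin (m - (∑ k, (t : ℝ) ^ dv k • Sv k).rank)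
    have hcard : Fintype.card Idx = ∑ t ∈ T, (Fintype.card (Fin m) - (∑ k, t ^ dv k • Sv k).rank) := by
      rw [Fintype.card_sigma]
      simp only [Fintype.card_fin]
      exact (Finset.sum_coe_sort T (fun t => m - (∑ k, t ^ dv k • Sv k).rank))
    have hbound : Fintype.card Idx ≤ B.rank := by
      refine card_posType_family_le_rank_two_gaps (I := Idx) A J B e f (fun p => ((p.1 : ℝ))) (fun p => v p.1 p.2)
        hA.posSemidef hJ hB.posSemidef (fun p => hTpos p.1 p.1.2) he hef
        (fun p => reduced_kernel_two_gaps A J B d₀ e f (hTpos p.1 p.1.2) _ (hv0 p.1 p.2)) ?_ ?_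
      · intro p
        have ht := hTpos p.1 p.1.2
        have hpos := hTtype p.1 p.1.2 (v p.1 p.2) (hv0 p.1 p.2) (hvne p.1 p.2)
        have heq := rayleigh_deriv_eq_two_gaps A J B d₀ e f ht _ (hv0 p.1 p.2)
        have h1 : 0 < (p.1 : ℝ) * (derivative (∑ k : Fin 3, C (v p.1 p.2 ⬝ᵥ ((![A, J, B] k) *ᵥ v p.1 p.2)) *
            (X : ℝ[X]) ^ (![d₀, d₀ + e, d₀ + e + f] k))).eval (p.1 : ℝ) := mul_pos ht hpos
        rw [heq] at h1
        have h2 : 0 < (p.1 : ℝ) ^ d₀ := pow_pos ht _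
        by_contra hcon
        push Not at hcon
        have h3 : (f : ℝ) * ((p.1 : ℝ)) ^ (e + f) * (v p.1 p.2 ⬝ᵥ (B *ᵥ v p.1 p.2))
            - e * (v p.1 p.2 ⬝ᵥ (A *ᵥ v p.1 p.2)) ≤ 0 := by linarith
        have := mul_nonpos_of_nonneg_of_nonpos h2.le h3
        linarith
      · rintro ⟨t, j⟩ ⟨t', j'⟩ hne htt'
        simp only at htt'
        have htt : t = t' := Subtype.ext htt'
        subst htt
        have hjj : j ≠ j' := fun h => hne (by subst h; rfl)
        exact hpol t j j' hjj
    have hNle : Multiset.card (P.roots.filter q) ≤ m := by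
      rw [← hN, ← hcard]
      exact hbound.trans hBm
    have hidx' : Multiset.card (P.roots.filter fun t => 0 < t ∧ negType t) = Multiset.card (P.roots.filter q) := hidx.symm
    rw [hidx']
    omega
  · -- `f ≤ e`: `N⁻ = Σ corank ≤ rank A`
    set q : ℝ → Prop := fun t => 0 < t ∧ negType t with hq
    set T := P.roots.toFinset.filter q with hTdef
    have hTpos : ∀ t ∈ T, 0 < t := fun t ht => (Finset.mem_filter.mp ht).2.1
    have hN : ∑ t ∈ T, (Fintype.card (Fin m) - (∑ k, t ^ dv k • Sv k).rank) = Multiset.card (P.roots.filter q) :=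
      Inertia.sum_corank_eq_card_roots_filter dv Sv hS q (hdefq q fun t ht => ht.1)
    have hTtype : ∀ t ∈ T, ∀ u : Fin m → ℝ, (∑ k, t ^ dv k • Sv k) *ᵥ u = 0 → u ≠ 0 →
        (derivative (∑ k, C (u ⬝ᵥ (Sv k *ᵥ u)) * (X : ℝ[X]) ^ dv k)).eval t < 0 :=
      fun t ht u hu hu0 => (Finset.mem_filter.mp ht).2.2 u hu hu0
    let Idx := Σ t : T, Fin (m - (∑ k, (t : ℝ) ^ dv k • Sv k).rank)
    have hcard : Fintype.card Idx = ∑ t ∈ T, (Fintype.card (Fin m) - (∑ k, t ^ dv k • Sv k).rank) := by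
      rw [Fintype.card_sigma]
      simp only [Fintype.card_fin]
      exact (Finset.sum_coe_sort T (fun t => m - (∑ k, t ^ dv k • Sv k).rank))
    have hbound : Fintype.card Idx ≤ A.rank := by
      refine card_negType_family_le_rank_two_gaps (I := Idx) A J B e f (fun p => ((p.1 : ℝ))) (fun p => v p.1 p.2)
        hA.posSemidef hJ hB.posSemidef (fun p => hTpos p.1 p.1.2) hf hfe
        (fun p => reduced_kernel_two_gaps A J B d₀ e f (hTpos p.1 p.1.2) _ (hv0 p.1 p.2)) ?_ ?_
      · intro p
        have ht := hTpos p.1 p.1.2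
        have hneg := hTtype p.1 p.1.2 (v p.1 p.2) (hv0 p.1 p.2) (hvne p.1 p.2)
        have heq := rayleigh_deriv_eq_two_gaps A J B d₀ e f ht _ (hv0 p.1 p.2)
        have h1 : (p.1 : ℝ) * (derivative (∑ k : Fin 3, C (v p.1 p.2 ⬝ᵥ ((![A, J, B] k) *ᵥ v p.1 p.2)) *
            (X : ℝ[X]) ^ (![d₀, d₀ + e, d₀ + e + f] k))).eval (p.1 : ℝ) < 0 := mul_neg_of_pos_of_neg ht hneg
        rw [heq] at h1
        have h2 : 0 < (p.1 : ℝ) ^ d₀ := pow_pos ht _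
        by_contra hcon
        push Not at hcon
        have h3 : 0 ≤ (f : ℝ) * ((p.1 : ℝ)) ^ (e + f) * (v p.1 p.2 ⬝ᵥ (B *ᵥ v p.1 p.2))
            - e * (v p.1 p.2 ⬝ᵥ (A *ᵥ v p.1 p.2)) := by linarith
        have := mul_nonneg h2.le h3
        linarith
      · rintro ⟨t, j⟩ ⟨t', j'⟩ hne htt'
        simp only at htt'
        have htt : t = t' := Subtype.ext htt'
        subst htt
        have hjj : j ≠ j' := fun h => hne (by subst h; rfl)
        exact hpol t j j' hjj
    have hNle : Multiset.card (P.roots.filter q) ≤ m := by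
      rw [← hN, ← hcard]
      exact hbound.trans hAm
    have hidx' : Multiset.card (P.roots.filter fun t => 0 < t ∧ ¬ negType t) = Multiset.card (P.roots.filter q) := hidx
    rw [hidx']
    omega

/-- **THE `2m` LAW ON EVERY SUPPORT `a < b < c`, DEFINITE TYPE (any corank)** — the previous theorem with `d₀ = a`, `e = b − a`,
`f = c − b`. [folklore] -/
theorem card_posRoots_le_two_mul_of_lt_of_definite (A J B : Matrix (Fin m) (Fin m) ℝ) (hA : A.PosDef) (hJ : J.IsSymm)
    (hB : B.PosDef) (a b c : ℕ) (hab : a < b) (hbc : b < c)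
    (htype : ∀ t : ℝ, 0 < t → (∑ k : Fin 3, t ^ (![a, b, c] k) • (![A, J, B] k)).det = 0 →
      (∀ u : Fin m → ℝ, (∑ k : Fin 3, t ^ (![a, b, c] k) • (![A, J, B] k)) *ᵥ u = 0 → u ≠ 0 →
        (derivative (∑ k : Fin 3, C (u ⬝ᵥ ((![A, J, B] k) *ᵥ u)) * (X : ℝ[X]) ^ (![a, b, c] k))).eval t < 0) ∨
      (∀ u : Fin m → ℝ, (∑ k : Fin 3, t ^ (![a, b, c] k) • (![A, J, B] k)) *ᵥ u = 0 → u ≠ 0 →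
        0 < (derivative (∑ k : Fin 3, C (u ⬝ᵥ ((![A, J, B] k) *ᵥ u)) * (X : ℝ[X]) ^ (![a, b, c] k))).eval t)) :
    Multiset.card ((Matrix.det (∑ k : Fin 3, ((X : ℝ[X]) ^ (![a, b, c] k)) • (![A, J, B] k).map C)).roots.filter
        (fun t => 0 < t)) ≤ 2 * m := by
  obtain ⟨e, rfl⟩ := Nat.exists_eq_add_of_lt hab
  obtain ⟨f, rfl⟩ := Nat.exists_eq_add_of_lt hbc
  have h := card_posRoots_le_two_mul_two_gaps_of_definite A J B hA hJ hB a (e + 1) (f + 1) (Nat.succ_pos e) (Nat.succ_pos f)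
  simp only [← Nat.add_assoc] at h
  exact h htype

end AllSupportsDefinite

end TwoSidedThree

end Summit.ValiantsHypothesis.ValiantsHypothesis.Theorems.KPlusLogSqLaw.TowerGraft
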